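import Literature.NumberTheory.GaloisRepresentations.DecompositionGroupOfCompletion
import Literature.NumberTheory.GaloisRepresentations.RamificationFiltrationProofs
import Literature.NumberTheory.GaloisRepresentations.AbsIntegersEquiv
import Literature.NumberTheory.GaloisRepresentations.ContinuousCorestriction
import Literature.NumberTheory.Automorphic.AdicCompletionLocalField
import HarnessLib

/-!
# From vanishing on `U ∩ I_𝔓` for all primes `𝔓 ∣ v` to principal conjugates on the local inertia group `I_{K_v}`
# — the bridge between the «stabiliser-of-`𝔓`» and the «embedding pull-back» dialects for inertia, on cocycles

Topic `NumberTheory/GaloisRepresentations`; namespace `Literature.NumberTheory.GaloisRepresentations`. THEOREMS ONLY (no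
definition, no named fact, no instance, no `sorry`). Number fields in `Type`.

Two dialects for «the class `x ∈ H¹(U, X)` (`U ≤ Γ_K` a subgroup, `X` any topological `Γ_K`-module) is unramified at the finite
place `v`» coexist in the tree:
(i) STABILISER dialect — `res_{U ⊓ I_𝔓} x = 0` for every prime `𝔓` of `ℤ̄_K` above `v` (`Ideal.inertia`, `HeightOneSpectrum.primesAbove`;
    e.g. Kato's `integralH1`: `∀ 𝔓 ∈ v.primesAbove, resLe T (inf_le_left : U ⊓ 𝔓.inertia Γ_ℚ ≤ U) 1 x = 0`);
(ii) EMBEDDING dialect — for a representative cocycle `ψ` and a conjugator `g ∈ Γ_K`, the conjugate `i ↦ ψ(g⁻¹ · i|_{K̄} · g)` is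
    PRINCIPAL on the local inertia group `I_{K_v} = absInertia K_v ≤ Γ_{K_v}` (restriction `absGaloisRestrict K K_v`, definitionally
    the tree's `resGalOfEmb (closureEmb K_v)`), i.e. `∃ b, ψ(g⁻¹ i|_{K̄} g) = (g⁻¹ i|_{K̄} g) • b − b` whenever `g⁻¹ i|_{K̄} g ∈ U` —
    the hypothesis `hinert` of `localization_shapiroLift_mem_unramifiedSubgroup` (`GaloisCohomology/CupProductLocalTermsShapiro`).

This file proves **(i) ⇒ (ii)** (`exists_forall_absInertia_conj_apply_eq_of_forall_primesAbove`): `I_{K_v}|_{K̄} = I_{𝔓₀}` for the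
prime `𝔓₀ = adicCompletionPrime K v` of the chosen embedding (`inertia_adicCompletionPrime_eq_map_absInertia`) and
`g⁻¹ I_{𝔓₀} g = I_{g⁻¹ 𝔓₀}` (`absIntegers.inertia_smul`) with `g⁻¹ 𝔓₀ ∈ v.primesAbove` (`smul_mem_primesAbove`); a class vanishing
on `U ⊓ I_𝔓` has every representative principal there (`resLe_oneCocycleClass`, `oneCocycleClass_eq_zero_iff`). Also the
ONE-prime form at `𝔓 = g⁻¹ 𝔓₀` (`…_of_resLe_eq_zero`) and the packaging over all coset representatives `s y₀`
(`forall_exists_forall_absInertia_conj_apply_eq_of_forall_primesAbove`, the literal shape of `hinert`).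

Consumer: the reciprocity stub (EH) of crux RSL_g `ResidualSignedLambdaLowerCMAtTwo` (`Summits/BirchSwinnertonDyer`): the Kato
classes `x_n ∈ integralH1` (dialect (i), `IwasawaH1DataCoeff.proj_mem`) feed (ShU) (dialect (ii)) through this lemma — STUB-PLAN
rev 13 T30/U39 («ONE landed bridge cited in ONE helper»).

## References
* J. Neukirch, *Algebraic Number Theory* (1999), Ch. II §9 Prop. (9.6) (`I_w(L|K) ≅ I(L_w|K_v)`), Ch. I §9 (conjugate primes).
  [NeukirchANT1999]
* J.-P. Serre, *Galois Cohomology* (1997), I §2.4, II §6.1. [SerreGaloisCohomology1997]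
-/

noncomputable section

open CategoryTheory Function Field NumberField IsDedekindDomain
open scoped NumberField Pointwise

namespace Literature.NumberTheory.GaloisRepresentations

open _root_.ContinuousCohomology _root_.TopRep
open Literature.NumberTheory.EllipticCurves (subgroupInclusion)

universe u

variable {R : Type u} [CommRing R] [TopologicalSpace R]
variable (K : Type) [Field K] [NumberField K]

/-- **Conjugates into the inertia group of the conjugate prime**: for `i ∈ I_{K_v}` and `g ∈ Γ_K`,
`g⁻¹ · i|_{K̄} · g ∈ I_{g⁻¹ 𝔓₀}`, `𝔓₀ = adicCompletionPrime K v` the prime of the chosen embedding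
(`I_{𝔓₀} = I_{K_v}|_{K̄}`, `I_{σ𝔓} = σ I_𝔓 σ⁻¹`). [cite: NeukirchANT1999, Ch. II §9 Prop. (9.6)] -/
theorem conj_absGaloisRestrict_mem_inertia_smul_adicCompletionPrime (v : HeightOneSpectrum (𝓞 K))
    (g : absoluteGaloisGroup K) {i : absoluteGaloisGroup (v.adicCompletion K)} (hi : i ∈ absInertia (v.adicCompletion K)) :
    g⁻¹ * absGaloisRestrict K (v.adicCompletion K) i * g ∈
      (g⁻¹ • adicCompletionPrime K v).inertia (absoluteGaloisGroup K) := by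
  rw [absIntegers.inertia_smul, Subgroup.mem_pointwise_smul_iff_inv_smul_mem, ← map_inv, inv_inv, MulAut.smul_def,
    MulAut.conj_apply, inertia_adicCompletionPrime_eq_map_absInertia]
  have e : g * (g⁻¹ * absGaloisRestrict K (v.adicCompletion K) i * g) * g⁻¹ =
      absGaloisRestrict K (v.adicCompletion K) i := by group
  rw [e]
  exact Subgroup.mem_map_of_mem _ hi

/-- **(i) ⇒ (ii), one prime**: if the class of `ψ` vanishes on `U ⊓ I_𝔓` for the prime `𝔓 = g⁻¹ 𝔓₀` above `v`
(`𝔓₀ = adicCompletionPrime K v`), then the conjugate `i ↦ ψ(g⁻¹ · i|_{K̄} · g)` is principal on `I_{K_v}` (inside `U`).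
[cite: NeukirchANT1999, Ch. II §9 Prop. (9.6)] [cite: SerreGaloisCohomology1997, I §2.4] -/
theorem exists_forall_absInertia_conj_apply_eq_of_resLe_eq_zero (X : TopRep.{0} R (absoluteGaloisGroup K))
    (U : Subgroup (absoluteGaloisGroup K)) (v : HeightOneSpectrum (𝓞 K)) (ψ : contOneCocycles (subgroupRep X U))
    (g : absoluteGaloisGroup K)
    (hψ : resLe X (inf_le_left : U ⊓ (g⁻¹ • adicCompletionPrime K v).inertia (absoluteGaloisGroup K) ≤ U) 1
      (oneCocycleClass _ ψ) = 0) :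
    ∃ b : X, ∀ i ∈ absInertia (v.adicCompletion K),
      ∀ hd : g⁻¹ * absGaloisRestrict K (v.adicCompletion K) i * g ∈ U,
        ψ.1 ⟨g⁻¹ * absGaloisRestrict K (v.adicCompletion K) i * g, hd⟩ =
          X.ρ (g⁻¹ * absGaloisRestrict K (v.adicCompletion K) i * g) b - b := by
  rw [resLe_oneCocycleClass, oneCocycleClass_eq_zero_iff] at hψ
  obtain ⟨b, hb⟩ := hψ
  refine ⟨b, fun i hi hd ↦ ?_⟩
  have key := hb ⟨g⁻¹ * absGaloisRestrict K (v.adicCompletion K) i * g,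
    Subgroup.mem_inf.mpr ⟨hd, conj_absGaloisRestrict_mem_inertia_smul_adicCompletionPrime K v g hi⟩⟩
  rw [contOneCocycles.pullback_apply, subgroupRep_ρ_apply] at key
  exact key

/-- **(i) ⇒ (ii): vanishing on `U ⊓ I_𝔓` for ALL primes `𝔓 ∣ v` gives principal conjugates on `I_{K_v}` for EVERY conjugator `g`.**
For any topological `Γ_K`-module `X`, subgroup `U ≤ Γ_K`, finite place `v`, cocycle `ψ : U → X` with
`∀ 𝔓 ∈ v.primesAbove, res_{U ⊓ I_𝔓}[ψ] = 0` (e.g. a Kato class in `integralH1`), and `g ∈ Γ_K`: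
`∃ b, ∀ i ∈ I_{K_v}, g⁻¹ i|_{K̄} g ∈ U → ψ(g⁻¹ i|_{K̄} g) = (g⁻¹ i|_{K̄} g) • b − b`.
[cite: NeukirchANT1999, Ch. II §9 Prop. (9.6)] [cite: SerreGaloisCohomology1997, I §2.4] -/
theorem exists_forall_absInertia_conj_apply_eq_of_forall_primesAbove (X : TopRep.{0} R (absoluteGaloisGroup K))
    (U : Subgroup (absoluteGaloisGroup K)) (v : HeightOneSpectrum (𝓞 K)) (ψ : contOneCocycles (subgroupRep X U))
    (hψ : ∀ 𝔓 ∈ v.primesAbove,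
      resLe X (inf_le_left : U ⊓ 𝔓.inertia (absoluteGaloisGroup K) ≤ U) 1 (oneCocycleClass _ ψ) = 0)
    (g : absoluteGaloisGroup K) :
    ∃ b : X, ∀ i ∈ absInertia (v.adicCompletion K),
      ∀ hd : g⁻¹ * absGaloisRestrict K (v.adicCompletion K) i * g ∈ U,
        ψ.1 ⟨g⁻¹ * absGaloisRestrict K (v.adicCompletion K) i * g, hd⟩ =
          X.ρ (g⁻¹ * absGaloisRestrict K (v.adicCompletion K) i * g) b - b :=
  exists_forall_absInertia_conj_apply_eq_of_resLe_eq_zero K X U v ψ g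
    (hψ _ (smul_mem_primesAbove (adicCompletionPrime_mem_primesAbove K v) g⁻¹))

/-- **Packaging over coset representatives** (the literal shape of `hinert` in `localization_shapiroLift_mem_unramifiedSubgroup`):
`∀ y₀, ∃ b, ∀ i ∈ I_{K_v}, (s y₀)⁻¹ i|_{K̄} (s y₀) ∈ U → ψ(…) = (…) • b − b`, from `∀ 𝔓 ∈ v.primesAbove, res_{U ⊓ I_𝔓}[ψ] = 0`.
[cite: NeukirchANT1999, Ch. II §9 Prop. (9.6)] [cite: SerreGaloisCohomology1997, I §2.4] -/
theorem forall_exists_forall_absInertia_conj_apply_eq_of_forall_primesAbove (X : TopRep.{0} R (absoluteGaloisGroup K))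
    (U : Subgroup (absoluteGaloisGroup K)) (v : HeightOneSpectrum (𝓞 K)) (ψ : contOneCocycles (subgroupRep X U))
    (hψ : ∀ 𝔓 ∈ v.primesAbove,
      resLe X (inf_le_left : U ⊓ 𝔓.inertia (absoluteGaloisGroup K) ≤ U) 1 (oneCocycleClass _ ψ) = 0)
    {ι : Type*} (s : ι → absoluteGaloisGroup K) :
    ∀ y₀ : ι, ∃ b : X, ∀ i ∈ absInertia (v.adicCompletion K),
      ∀ hd : (s y₀)⁻¹ * absGaloisRestrict K (v.adicCompletion K) i * s y₀ ∈ U,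
        ψ.1 ⟨(s y₀)⁻¹ * absGaloisRestrict K (v.adicCompletion K) i * s y₀, hd⟩ =
          X.ρ ((s y₀)⁻¹ * absGaloisRestrict K (v.adicCompletion K) i * s y₀) b - b :=
  fun y₀ ↦ exists_forall_absInertia_conj_apply_eq_of_forall_primesAbove K X U v ψ hψ (s y₀)

/-- **Zero witness**: if `ψ` itself VANISHES on `U ⊓ I_𝔓` for all `𝔓 ∣ v` (as a function), the conjugates vanish on `I_{K_v}` —
the witness `b = 0`. [cite: NeukirchANT1999, Ch. II §9 Prop. (9.6)] -/
theorem forall_absInertia_conj_apply_eq_zero_of_forall_primesAbove (X : TopRep.{0} R (absoluteGaloisGroup K))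
    (U : Subgroup (absoluteGaloisGroup K)) (v : HeightOneSpectrum (𝓞 K)) (ψ : contOneCocycles (subgroupRep X U))
    (hψ : ∀ 𝔓 ∈ v.primesAbove, ∀ u : U, (u : absoluteGaloisGroup K) ∈ 𝔓.inertia (absoluteGaloisGroup K) → ψ.1 u = 0)
    (g : absoluteGaloisGroup K) {i : absoluteGaloisGroup (v.adicCompletion K)} (hi : i ∈ absInertia (v.adicCompletion K))
    (hd : g⁻¹ * absGaloisRestrict K (v.adicCompletion K) i * g ∈ U) :
    ψ.1 ⟨g⁻¹ * absGaloisRestrict K (v.adicCompletion K) i * g, hd⟩ = 0 :=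
  hψ _ (smul_mem_primesAbove (adicCompletionPrime_mem_primesAbove K v) g⁻¹) ⟨_, hd⟩
    (conj_absGaloisRestrict_mem_inertia_smul_adicCompletionPrime K v g hi)

/-! ## Torsion coefficients: principal conjugates + TRIVIAL inertia action ⟹ VANISHING conjugates (the Selmer side) -/

/-- **Principal on `I_{K_v}` after an injective coefficient map into a module with TRIVIAL inertia action ⟹ zero on `I_{K_v}`.**
For topological `Γ_K`-modules `X`, `Y`, an injective additive `f : X → Y`, a cocycle `ψ : U → X`, a conjugator `g` and a finite place
`v` at which `I_{K_v}` acts trivially on `Y` (e.g. `Y = A` a Galois module UNRAMIFIED at `v`, `X = A[N]`, `f` the inclusion): if the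
conjugate `i ↦ f(ψ(g⁻¹ i|_{K̄} g))` is principal on `I_{K_v}` (e.g. the image of `[ψ]` in `H¹(U, A)` is unramified at every prime above
`v`, via `exists_forall_absInertia_conj_apply_eq_of_forall_primesAbove`), then `ψ(g⁻¹ i|_{K̄} g) = 0` for all `i ∈ I_{K_v}` with
`g⁻¹ i|_{K̄} g ∈ U` — the coboundary `(g⁻¹ i g) • b − b` vanishes identically. [cite: NeukirchANT1999, Ch. II §9 Prop. (9.6)]
[cite: SerreGaloisCohomology1997, I §2.4] -/
theorem forall_absInertia_conj_apply_eq_zero_of_principal_of_trivial (X Y : TopRep.{0} R (absoluteGaloisGroup K))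
    (f : X →+ Y) (hf : Function.Injective f) (U : Subgroup (absoluteGaloisGroup K)) (v : HeightOneSpectrum (𝓞 K))
    (ψ : contOneCocycles (subgroupRep X U)) (g : absoluteGaloisGroup K)
    (htriv : ∀ i ∈ absInertia (v.adicCompletion K), ∀ y : Y, Y.ρ (absGaloisRestrict K (v.adicCompletion K) i) y = y)
    (hprin : ∃ b : Y, ∀ i ∈ absInertia (v.adicCompletion K),
      ∀ hd : g⁻¹ * absGaloisRestrict K (v.adicCompletion K) i * g ∈ U,
        f (ψ.1 ⟨g⁻¹ * absGaloisRestrict K (v.adicCompletion K) i * g, hd⟩) =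
          Y.ρ (g⁻¹ * absGaloisRestrict K (v.adicCompletion K) i * g) b - b) :
    ∀ i ∈ absInertia (v.adicCompletion K), ∀ hd : g⁻¹ * absGaloisRestrict K (v.adicCompletion K) i * g ∈ U,
      ψ.1 ⟨g⁻¹ * absGaloisRestrict K (v.adicCompletion K) i * g, hd⟩ = 0 := by
  obtain ⟨b, hb⟩ := hprin
  intro i hi hd
  have hconj : Y.ρ (g⁻¹ * absGaloisRestrict K (v.adicCompletion K) i * g) b = b := by
    rw [ρ_mul_apply, ρ_mul_apply, htriv i hi, ρ_inv_apply_ρ_apply]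
  have h := hb i hi hd
  rw [hconj, sub_self] at h
  exact hf (by rw [h, map_zero])

/-- **The Selmer-side `hinert`, packaged**: under the hypotheses of `forall_absInertia_conj_apply_eq_zero_of_principal_of_trivial` for every
coset representative `s y₀`, the hypothesis `hinert` of `localization_shapiroLift_mem_unramifiedSubgroup` holds for `ψ` with the witness `b = 0`.
[cite: NeukirchANT1999, Ch. II §9 Prop. (9.6)] [cite: SerreGaloisCohomology1997, I §2.4] -/
theorem forall_exists_forall_absInertia_conj_apply_eq_of_principal_of_trivial (X Y : TopRep.{0} R (absoluteGaloisGroup K))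
    (f : X →+ Y) (hf : Function.Injective f) (U : Subgroup (absoluteGaloisGroup K)) (v : HeightOneSpectrum (𝓞 K))
    (ψ : contOneCocycles (subgroupRep X U))
    (htriv : ∀ i ∈ absInertia (v.adicCompletion K), ∀ y : Y, Y.ρ (absGaloisRestrict K (v.adicCompletion K) i) y = y)
    {ι : Type*} (s : ι → absoluteGaloisGroup K)
    (hprin : ∀ y₀ : ι, ∃ b : Y, ∀ i ∈ absInertia (v.adicCompletion K),
      ∀ hd : (s y₀)⁻¹ * absGaloisRestrict K (v.adicCompletion K) i * s y₀ ∈ U,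
        f (ψ.1 ⟨(s y₀)⁻¹ * absGaloisRestrict K (v.adicCompletion K) i * s y₀, hd⟩) =
          Y.ρ ((s y₀)⁻¹ * absGaloisRestrict K (v.adicCompletion K) i * s y₀) b - b) :
    ∀ y₀ : ι, ∃ b : X, ∀ i ∈ absInertia (v.adicCompletion K),
      ∀ hd : (s y₀)⁻¹ * absGaloisRestrict K (v.adicCompletion K) i * s y₀ ∈ U,
        ψ.1 ⟨(s y₀)⁻¹ * absGaloisRestrict K (v.adicCompletion K) i * s y₀, hd⟩ =
          X.ρ ((s y₀)⁻¹ * absGaloisRestrict K (v.adicCompletion K) i * s y₀) b - b :=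
  fun y₀ ↦ ⟨0, fun i hi hd ↦ by
    rw [map_zero, sub_zero]
    exact forall_absInertia_conj_apply_eq_zero_of_principal_of_trivial K X Y f hf U v ψ (s y₀) htriv (hprin y₀) i hi hd⟩

/-- **Principal cocycles push forward to principal cocycles**: if `i ↦ ψ(g⁻¹ i|_{K̄} g)` is principal on `I_{K_v}` for `X`-coefficients, so
is `f ∘ ψ` for any equivariant additive `f : X → Y` (`f (x • b − b) = x • f b − f b`). [cite: SerreGaloisCohomology1997, I §2.4] -/
theorem exists_forall_absInertia_conj_map_apply_eq_of_exists (X Y : TopRep.{0} R (absoluteGaloisGroup K))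
    (f : X →+ Y) (hfρ : ∀ (x : absoluteGaloisGroup K) (a : X), f (X.ρ x a) = Y.ρ x (f a))
    (U : Subgroup (absoluteGaloisGroup K)) (v : HeightOneSpectrum (𝓞 K)) (ψ : contOneCocycles (subgroupRep X U)) (g : absoluteGaloisGroup K)
    (hprin : ∃ b : X, ∀ i ∈ absInertia (v.adicCompletion K),
      ∀ hd : g⁻¹ * absGaloisRestrict K (v.adicCompletion K) i * g ∈ U,
        ψ.1 ⟨g⁻¹ * absGaloisRestrict K (v.adicCompletion K) i * g, hd⟩ =
          X.ρ (g⁻¹ * absGaloisRestrict K (v.adicCompletion K) i * g) b - b) :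
    ∃ b : Y, ∀ i ∈ absInertia (v.adicCompletion K),
      ∀ hd : g⁻¹ * absGaloisRestrict K (v.adicCompletion K) i * g ∈ U,
        f (ψ.1 ⟨g⁻¹ * absGaloisRestrict K (v.adicCompletion K) i * g, hd⟩) =
          Y.ρ (g⁻¹ * absGaloisRestrict K (v.adicCompletion K) i * g) b - b := by
  obtain ⟨b, hb⟩ := hprin
  exact ⟨f b, fun i hi hd ↦ by rw [hb i hi hd, map_sub, hfρ]⟩

end Literature.NumberTheory.GaloisRepresentations

end
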